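import Summits.BirchSwinnertonDyer.BirchSwinnertonDyer.Theorems.CMKolyvaginAtInertTwoLowerLevelTwoEngineAtTwo
import Summits.BirchSwinnertonDyer.BirchSwinnertonDyer.Theorems.CMKolyvaginAtInertTwoLowerEngineDeepAtTwo
import Summits.BirchSwinnertonDyer.BirchSwinnertonDyer.Theorems.CMKolyvaginAtInertTwoLowerCebotarevAtTwo
import HarnessLib

/-!
# Route `CMKolyvaginAtInertTwo`, crux `CMKolyvaginExactAtInertTwo` (stmt-BirchSwinnertonDyer-24277), `stub_lower` — W-UP on H₂,
# FILE W4b: THE LEVEL-`2` ENGINE WITH THE NEW PRIME CHOSEN DEEP BY ČEBOTAREV ON THE CM-INERT HABITAT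

Seat `bsd-line-cmk2-p1` g19 (cell `bsd-print-cf2`), `--supports stmt-BirchSwinnertonDyer-24277` (helper; closes nothing).
THEOREMS ONLY (no definition, no named fact, no `sorry`).  BSD is NOT proved by any of this; the crux is not closed here.

WHY.  File W3b's `false_of_levelTwo_engine` asks, for every auxiliary `y`, for a new Gross–Kolyvagin place `ℓ′` with the Čebotarev
clauses for `(c₁(n), res_K y)` and the `K`-side bookkeeping there.  THIS FILE chooses `ℓ′` — DEEP (`Frob_{ℓ′} = Frob_∞` on `K(E[4])`,
index `≥ 2`) and outside any finite exceptional set — by this seat's CM-inert pair Čebotarev at level `2` transported to depth `4`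
(`infinite_kolyvaginPrime_localization_fullOrder_pair_deep_of_cmInert`, file B0; classes `c₁(n)` and `res_K y` of order `2`, the latter
`τ`-fixed, the former `τ`-eigen), exactly as file C1a did at level `4`, and leaves the caller (file W4c, the closure on H₂) only the
bookkeeping AS A FUNCTION OF `ℓ′`: the datum at `nℓ′`, its class `c₁(nℓ′)` and descent `Z`, (Kum), (Q2) at `λ′` and at the shallow own
primes against the VANISHING swapped classes, and the transversality (tr) of `Z` at the deep own primes (file W4a).
* **`false_of_levelTwo_engine_deep`**.

References: [McCallumLMS1991] §5 proof of Prop. 5.2; [GrossLMS1991] Prop. 6.2, §9; [MilneADT2006] I Thm. 4.10.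
-/

set_option autoImplicit false
-- the Theorems namespace of this sub repeats the summit name by design (D-0017 nested layout)
set_option linter.dupNamespace false

noncomputable section

open scoped Classical

open Field NumberField IsDedekindDomain Function WeierstrassCurve Rat.HeightOneSpectrum
open Literature.NumberTheory.EllipticCurves
open Literature.NumberTheory.GaloisRepresentations
open Literature.NumberTheory.GaloisCohomology
open Summit.BirchSwinnertonDyer.Rank1Residual.X11b.Relaxation
open Summit.BirchSwinnertonDyer.BirchSwinnertonDyer.Theorems.GenusExact
open Summit.BirchSwinnertonDyer.BirchSwinnertonDyer.Theorems.GenusExact.RelaxedCount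
open Summit.BirchSwinnertonDyer.BirchSwinnertonDyer.Theorems.GenusExact.SelmerDescent
open Summit.BirchSwinnertonDyer.BirchSwinnertonDyer.Theorems.GenusExact.VisiblePairAtTwo

namespace Summit.BirchSwinnertonDyer.BirchSwinnertonDyer.Theorems.KolyvaginLowerTwo

variable (W : WeierstrassCurve ℚ) [W.IsElliptic] [W.IsGloballyMinimal]

set_option maxHeartbeats 400000 in
/-- **The level-2 engine with a DEEP Čebotarev prime, modulo the `K`-side bookkeeping as a function of `ℓ′`.**  `E ∈ H₂` (CM, `2` inert
in the CM field, `ρ̄_{E,2}` onto; hence `Δ < 0`); `K = ℚ(θ)`, `θ² = c`, imaginary quadratic, Heegner; `σ ≠ 1`; `u` the genus place with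
`#H¹(ℚ_u, E[2]) ≤ 4` and the descent plumbing `hdesc` off `u`; `s ≠ ∅` (shallow) and `t` (deep) disjoint sets of places of Gross–Kolyvagin
primes (index `≥ 1`) avoiding `u`; `c_K = c₁(n)` of order `2`, `σ`-eigen; its descent `b ≠ 0`, Kummer off `s ∪ {u} ∪ t`, zero on `s`,
transverse on `t`.  IF for every auxiliary `y ≠ 0` (Kummer off `s ∪ {u} ∪ t`) there is a finite exceptional set `S₀` such that for every
prime `ℓ′ ∉ S₀`, Zhang–Kolyvagin with `Frob = Frob_∞` on `K(E[4])` and index `≥ 2`, with places `λ′ ∣ v′ ∌` own primes, and the Čebotarev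
clauses for `c_K` and `res_K y` at `λ′` (exponent `1`), the caller supplies `Z`, `c_K′` with (desc), (Kum), (Q2@λ′), the shallow-prime
clauses against vanishing swapped classes, and (tr) — THEN `False`. [cite: McCallumLMS1991, §5 proof of Prop. 5.2]
[cite: GrossLMS1991, Prop. 6.2, §9] [cite: MilneADT2006, Ch. I, Thm. 4.10] -/
theorem false_of_levelTwo_engine_deep [NeZero (W.conductorNorm ℤ)] (hCM : W.HasCM) (hin : Rank1Residual.CMInert W 2)
    (hρ2 : W.HasSurjectiveModNGaloisRep 2)
    {K : Type} [Field K] [NumberField K] (hK : IsImaginaryQuadratic K)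
    (hH : SatisfiesHeegnerHypothesis (W.conductorNorm ℤ) K)
    {θ : K} (hθ : θ ∉ (algebraMap ℚ K).range) {c : ℤ} (hc : θ ^ 2 = algebraMap ℚ K c)
    (σ : K ≃ₐ[ℚ] K) (hσ : σ ≠ 1)
    (u : HeightOneSpectrum (𝓞 ℚ))
    (hPu : Nat.card (galoisCohomology ((W.torsionGaloisModule ((2 ^ 1 : ℕ) : ℤ)).toLocal (Sum.inr u : Place ℚ)) 1) ≤ 4)
    (hdesc : ∀ (ξ : galH1Torsion W ((2 ^ 1 : ℕ) : ℤ)) (v : HeightOneSpectrum (𝓞 ℚ)), v ≠ u →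
      (∀ w : HeightOneSpectrum (𝓞 K), w.under (𝓞 ℚ) = v →
        resTorsion W K ((2 ^ 1 : ℕ) : ℤ) ξ ∈ selmerLocalKer (W.baseChange K) (w.adicCompletion K) ((2 ^ 1 : ℕ) : ℤ)) →
      ξ ∈ selmerLocalKer W (v.adicCompletion ℚ) ((2 ^ 1 : ℕ) : ℤ))
    (s t : Finset (Place ℚ)) (hst : Disjoint s t) (hs : s.Nonempty) (hus : (Sum.inr u : Place ℚ) ∉ s)
    (hut : (Sum.inr u : Place ℚ) ∉ t)
    (hTK : ∀ u' ∈ s ∪ t, ∃ (v : HeightOneSpectrum (𝓞 ℚ)) (ℓ : ℕ) (_ : Fact ℓ.Prime), u' = Sum.inr v ∧ ℓ ≠ 2 ∧ (ℓ : 𝓞 ℚ) ∈ v.asIdeal ∧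
      W.HasGoodReductionAtPrime ℓ ∧ FrobEqFrobInfty W K 2 ℓ ∧ 1 ≤ Zhang2014.kolyvaginIndex W 2 ℓ ∧
      Zhang2014.IsKolyvaginPrime (W.conductorNorm ℤ) W K 2 ℓ)
    -- the Kolyvagin class `c₁(n)`: order `2`, eigen
    (cK : galH1Torsion (W.baseChange K) ((2 ^ 1 : ℕ) : ℤ)) (hcK2 : addOrderOf cK = 2 ^ 1)
    {sK : ℤ} (hsK : sK = 1 ∨ sK = -1) (hτcK : conjAct W σ ((2 ^ 1 : ℕ) : ℤ) cK = sK • cK)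
    -- its descent `b`, in the dual structure
    {b : galoisCohomology (W.torsionGaloisModule ((2 ^ 1 : ℕ) : ℤ)) 1}
    (hbT : b ∈ kummerOutside W (2 ^ 1) (s ∪ {(Sum.inr u : Place ℚ)} ∪ t))
    (hbS : ∀ u' ∈ s, galoisCohomology.localization (W.torsionGaloisModule ((2 ^ 1 : ℕ) : ℤ)) u' 1 b = 0)
    (hbt : ∀ v : HeightOneSpectrum (𝓞 ℚ), Sum.inr v ∈ t →
      ∀ 𝔓 ∈ v.primesAbove, ∀ F c₀ : absoluteGaloisGroup ℚ, IsArithFrobAt (𝓞 ℚ) F 𝔓 →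
        IsComplexConjugation (Rat.castHom ℝ) c₀ → (∀ P : geomTorsion W ((2 ^ 1 : ℕ) : ℤ), F • P = c₀ • P) →
        ∃ P₁ : geomTorsion W ((2 ^ 1 : ℕ) : ℤ), h1Eval W _ b F = F • P₁ - P₁)
    (hb : b ≠ 0)
    -- the `K`-side bookkeeping at the new DEEP prime, as a function of `ℓ′`
    (hstep : ∀ y ∈ kummerOutside W (2 ^ 1) (s ∪ {(Sum.inr u : Place ℚ)} ∪ t), y ≠ 0 → ∃ S₀ : Finset ℕ,
      ∀ (ℓ' : ℕ) (v' : HeightOneSpectrum (𝓞 ℚ)) (w' : HeightOneSpectrum (𝓞 K)), w'.under (𝓞 ℚ) = v' →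
        ℓ' ∉ S₀ → ℓ'.Prime → (ℓ' : 𝓞 ℚ) ∈ v'.asIdeal → (ℓ' : 𝓞 K) ∈ w'.asIdeal →
        Zhang2014.IsKolyvaginPrime (W.conductorNorm ℤ) W K 2 ℓ' → FrobEqFrobInfty W K (2 ^ 2) ℓ' →
        2 ≤ Zhang2014.kolyvaginIndex W 2 ℓ' → (Sum.inr v' : Place ℚ) ∉ s ∪ {(Sum.inr u : Place ℚ)} ∪ t →
        (∀ j : ℕ, ((2 ^ j : ℕ) : ℤ) • cK ∈ (W.baseChange K).torsionLocalKer (w'.adicCompletion K) ((2 ^ 1 : ℕ) : ℤ) ↔ 1 ≤ j) →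
        (∀ j : ℕ, ((2 ^ j : ℕ) : ℤ) • resTorsion W K ((2 ^ 1 : ℕ) : ℤ) y ∈
          (W.baseChange K).torsionLocalKer (w'.adicCompletion K) ((2 ^ 1 : ℕ) : ℤ) ↔ 1 ≤ j) →
        ∃ (Z : galoisCohomology (W.torsionGaloisModule ((2 ^ 1 : ℕ) : ℤ)) 1)
          (cK' : galH1Torsion (W.baseChange K) ((2 ^ 1 : ℕ) : ℤ)),
          resTorsion W K ((2 ^ 1 : ℕ) : ℤ) Z = cK' ∧
          (∀ v : HeightOneSpectrum (𝓞 ℚ), (Sum.inr v : Place ℚ) ∉ insert (Sum.inr v' : Place ℚ) (s ∪ {(Sum.inr u : Place ℚ)} ∪ t) →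
            ∀ w : HeightOneSpectrum (𝓞 K), w.under (𝓞 ℚ) = v →
              cK' ∈ selmerLocalKer (W.baseChange K) (w.adicCompletion K) ((2 ^ 1 : ℕ) : ℤ)) ∧
          ((cK' ∈ selmerLocalKer (W.baseChange K) (w'.adicCompletion K) ((2 ^ 1 : ℕ) : ℤ) ↔
              cK' ∈ (W.baseChange K).torsionLocalKer (w'.adicCompletion K) ((2 ^ 1 : ℕ) : ℤ)) ∧
            (cK' ∈ (W.baseChange K).torsionLocalKer (w'.adicCompletion K) ((2 ^ 1 : ℕ) : ℤ) ↔
              cK ∈ (W.baseChange K).torsionLocalKer (w'.adicCompletion K) ((2 ^ 1 : ℕ) : ℤ))) ∧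
          (∀ u' ∈ s, ∃ (v : HeightOneSpectrum (𝓞 ℚ)) (ℓ : ℕ) (w : HeightOneSpectrum (𝓞 K)) (_ : w.asIdeal.LiesOver v.asIdeal)
            (cKu : galH1Torsion (W.baseChange K) ((2 ^ 1 : ℕ) : ℤ)),
            u' = Sum.inr v ∧ ℓ.Prime ∧ (ℓ : 𝓞 ℚ) ∈ v.asIdeal ∧ ((c : ℤ) : 𝓞 ℚ) ∉ v.asIdeal ∧ FrobEqFrobInfty W K 2 ℓ ∧
            w.asIdeal.inertiaDeg (𝓞 ℚ) = 2 ∧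
            (cK' ∈ (W.baseChange K).torsionLocalKer (w.adicCompletion K) ((2 ^ 1 : ℕ) : ℤ) ↔
              cKu ∈ (W.baseChange K).torsionLocalKer (w.adicCompletion K) ((2 ^ 1 : ℕ) : ℤ)) ∧
            cKu = 0) ∧
          (∀ v : HeightOneSpectrum (𝓞 ℚ), Sum.inr v ∈ t →
            ∀ 𝔓 ∈ v.primesAbove, ∀ F c₀ : absoluteGaloisGroup ℚ, IsArithFrobAt (𝓞 ℚ) F 𝔓 →
              IsComplexConjugation (Rat.castHom ℝ) c₀ → (∀ P : geomTorsion W ((2 ^ 1 : ℕ) : ℤ), F • P = c₀ • P) →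
              ∃ P₁ : geomTorsion W ((2 ^ 1 : ℕ) : ℤ), h1Eval W _ Z F = F • P₁ - P₁)) :
    False := by
  haveI : Fact (Nat.Prime 2) := ⟨Nat.prime_two⟩
  have h2K : Module.finrank ℚ K = 2 := hK.1
  haveI : IsGalois ℚ K := isGalois_of_finrank_eq_two K h2K
  have hΔ : W.Δ < 0 := KolyvaginEigenTwo.Δ_neg_of_cmInert_two W hCM hin hρ2
  -- `θ ∉ ℚ` in the `Set.range` form, and `c ≠ 0`
  have hθ' : θ ∉ Set.range (algebraMap ℚ K) := fun ⟨q, hq⟩ ↦ hθ ⟨q, hq⟩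
  have hc0 : c ≠ 0 := by
    rintro rfl
    apply hθ
    refine ⟨0, ?_⟩
    have h0 : θ ^ 2 = 0 := by rw [hc]; simp
    rw [map_zero]
    exact (pow_eq_zero_iff two_ne_zero).mp h0 |>.symm
  -- injectivity of `res_K` at level `2`
  have hinj : Injective (resTorsion W K ((2 ^ 1 : ℕ) : ℤ)) :=
    (EigenClassesFinite.eigen_description_two_pow_of_hasSurjectiveModNGaloisRep_two W K h2K hθ'
      (c := (c : ℚ)) (by exact_mod_cast hc) hρ2 1).1
  -- the frame data of `s ∪ t` without the Kolyvagin predicate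
  have hTK₀ : ∀ u' ∈ s ∪ t, ∃ (v : HeightOneSpectrum (𝓞 ℚ)) (ℓ : ℕ) (_ : Fact ℓ.Prime), u' = Sum.inr v ∧ ℓ ≠ 2 ∧
      (ℓ : 𝓞 ℚ) ∈ v.asIdeal ∧ W.HasGoodReductionAtPrime ℓ ∧ FrobEqFrobInfty W K 2 ℓ ∧ 1 ≤ Zhang2014.kolyvaginIndex W 2 ℓ := by
    intro u' hu'
    obtain ⟨v, ℓ, hℓp, huv, hℓ2, hℓv, hgood, hFrob, hidx, -⟩ := hTK u' hu'
    exact ⟨v, ℓ, hℓp, huv, hℓ2, hℓv, hgood, hFrob, hidx⟩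
  refine false_of_levelTwo_engine W hΔ hK hθ hc u hPu hdesc s t hst hs hus hut hTK₀ hbT hbS hbt hb fun y hyKO hy0 _ ↦ ?_
  -- ### `res_K y`: order `2`, `σ`-fixed
  set yK := resTorsion W K ((2 ^ 1 : ℕ) : ℤ) y with hyK_def
  have hyK0 : ¬ 2 ^ 0 • yK = 0 := by
    rw [pow_zero, one_smul]
    intro h
    exact hy0 ((injective_iff_map_eq_zero _).mp hinj _ h)
  have hyK2 : 2 ^ (0 + 1) • yK = 0 := by
    have h : (((2 ^ 1 : ℕ) : ℤ)) • yK = 0 := zsmul_discreteH1_torsion _ yK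
    rw [natCast_zsmul] at h
    exact h
  have hyKord : addOrderOf yK = 2 ^ 1 := addOrderOf_eq_prime_pow hyK0 hyK2
  have hτY : conjAct W σ ((2 ^ 1 : ℕ) : ℤ) yK = (1 : ℤ) • yK := by
    rw [one_zsmul, hyK_def, conjAct_resTorsion K W _ σ h2K hσ y]
  -- ### the exceptional set and the DEEP Čebotarev prime
  obtain ⟨S₀, hS₀⟩ := hstep y hyKO hy0
  set Sst : Finset ℕ := ((s ∪ {(Sum.inr u : Place ℚ)} ∪ t).preimage Sum.inr Sum.inr_injective.injOn).image natGenerator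
    with hSst_def
  set E : Finset ℕ := S₀ ∪ Sst ∪ c.natAbs.primeFactors with hE_def
  have hinf := infinite_kolyvaginPrime_localization_fullOrder_pair_deep_of_cmInert W K hCM hin hρ2 hK hH σ hσ 1 1 le_rfl cK yK
    (m := 1) (κ := 1) le_rfl le_rfl hcK2 hyKord hsK (Or.inl rfl) hτcK hτY
  obtain ⟨ℓ', hℓ'mem, hℓ'E⟩ := hinf.exists_notMem_finset E
  obtain ⟨hFrob4, hKol', hidx2, hloc'⟩ := hℓ'mem
  have hℓ'p : ℓ'.Prime := hKol'.1
  haveI : Fact ℓ'.Prime := ⟨hℓ'p⟩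
  have hFrob4' : FrobEqFrobInfty W K (2 ^ 2) ℓ' := hFrob4
  have hidx2' : 2 ≤ Zhang2014.kolyvaginIndex W 2 ℓ' := hidx2
  have hFrob2' : FrobEqFrobInfty W K 2 ℓ' := hFrob4'.of_dvd ⟨2, by norm_num⟩
  have hℓ'S₀ : ℓ' ∉ S₀ := fun h ↦ hℓ'E (by simp [hE_def, h])
  have hℓ'Sst : ℓ' ∉ Sst := fun h ↦ hℓ'E (by simp [hE_def, h])
  have hℓ'c : ¬ ((ℓ' : ℤ) ∣ c) := by
    intro h
    apply hℓ'E
    have : ℓ' ∈ c.natAbs.primeFactors :=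
      Nat.mem_primeFactors.mpr ⟨hℓ'p, Int.natCast_dvd.mp h, Int.natAbs_ne_zero.mpr hc0⟩
    simp [hE_def, this]
  -- the place `v′` of `ℚ` and the inert place `w′` of `K`
  set v' : HeightOneSpectrum (𝓞 ℚ) := primesEquiv.symm ⟨ℓ', hℓ'p⟩ with hv'_def
  have hℓ'v' : (ℓ' : 𝓞 ℚ) ∈ v'.asIdeal := natCast_mem_primesEquiv_symm hℓ'p
  have hv'out : (Sum.inr v' : Place ℚ) ∉ s ∪ {(Sum.inr u : Place ℚ)} ∪ t := by
    intro h
    apply hℓ'Sst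
    rw [hSst_def, Finset.mem_image]
    exact ⟨v', Finset.mem_preimage.mpr h, natGenerator_eq_of_natCast_prime_mem hℓ'p hℓ'v'⟩
  obtain ⟨w', hℓ'w'⟩ := exists_natCast_mem (K := K) hℓ'p
  haveI hw'v' : w'.asIdeal.LiesOver v'.asIdeal := liesOver_of_natCast_mem hℓ'p hℓ'v' hℓ'w'
  have hw'u : w'.under (𝓞 ℚ) = v' :=
    HeightOneSpectrum.ext (by rw [HeightOneSpectrum.under_asIdeal]; exact (Ideal.LiesOver.over (P := w'.asIdeal) (p := v'.asIdeal)).symm)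
  have hf' : w'.asIdeal.inertiaDeg (𝓞 ℚ) = 2 :=
    inertiaDeg_eq_two_of_span_isPrime h2K hℓ'p hKol'.2.2.2.2.1 hℓ'v' hℓ'w'
  have hℓ'2 : ℓ' ≠ 2 := hKol'.2.2.2.1
  have hgood' : W.HasGoodReductionAtPrime ℓ' := hasGoodReductionAtPrime_of_not_dvd_conductorNorm W hKol'.2.1
  have hcv' : ((c : ℤ) : 𝓞 ℚ) ∉ v'.asIdeal := intCast_notMem_of_not_dvd hℓ'p hℓ'v' hℓ'c
  have hidx1' : 1 ≤ Zhang2014.kolyvaginIndex W 2 ℓ' := le_trans (by norm_num) hidx2'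
  obtain ⟨hOrdX, hOrdY⟩ := hloc' w' hℓ'w'
  -- ### the bookkeeping at `ℓ′`
  obtain ⟨Z, cK', hZ, hKum, hRel, hfree, htr⟩ :=
    hS₀ ℓ' v' w' hw'u hℓ'S₀ hℓ'p hℓ'v' hℓ'w' hKol' hFrob4' hidx2' hv'out hOrdX hOrdY
  exact ⟨v', ℓ', ⟨hℓ'p⟩, w', hw'u, Z, cK, cK', hv'out, hℓ'2, hℓ'v', hgood', hcv', hFrob2', hidx1', hf', hZ, hKum, hRel, hOrdX,
    hOrdY, hfree, htr⟩

end Summit.BirchSwinnertonDyer.BirchSwinnertonDyer.Theorems.KolyvaginLowerTwo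

end
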